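import Summits.HodgeConjecture.HodgeConjecture.Theorems.Ring2AbelianAllEvenTimesEven
import HarnessLib

/-!
# Ring 2 · AbelianAll (seat `ab-weil-2`, gen 4, file 2) — EVEN × EVEN, continued: the COMPONENT MULTIPLICATION LAW
  `(n_A, δ_A) · (n_B, δ_B) ↦ (n_A + n_B, δ_A δ_B)` on the carriers, the non-hyperbolic converse, and SURFACE × FOURFOLD sixfolds
  with their Weil classes from ONE hyperbolic-sixfold fact (Koike / Schoen refereed; Markman F2 unrefereed)

HONEST FRAMING (sub-cell `pub-hodge-ring2-ab-*`, verbatim): research route, not a corollary; conditional on HC_CM plus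
one named minimal statement. (Cell `pub-hodge-ring2`, verbatim: research route conditional on HC_CM; not a corollary;
Q11.4-sentence-2 already refuted in dim ≥ 3.) `HC_CM` does not occur here. No definition, no named fact, no `sorry`; the
printed sixfold theorems enter as BINDERS (`hM`, `hK`, `hS3`).

WHAT IS PROVED. §1 `exists_ksymm_hasWeilDiscriminantNondeg_prod` — the COMPONENT MULTIPLICATION LAW: if the `K`-symmetrised
hyperplane classes of `(A, φ, e_A, a_A)` (`dim A = 2n_A`) and `(B, ψ, e_B, a_B)` (`dim B = 2n_B`) have non-degenerate discriminant
classes `δ_A`, `δ_B`, then `A × B` carries a projective embedding `e` and a rational ambient class `a ≠ 0` whose `K`-symmetrised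
hyperplane class (for `φ × ψ`) has non-degenerate class `δ_A · δ_B` — NO Weil-type hypothesis (the Segre embedding of the given
embeddings, `Ring2AbelianAllEvenTimesEven.exists_segreEmbedding_prod_of_classes`, and ab-weil-1's `hasWeilDiscriminantNondeg_prod`);
so a member of `(n_A, d, δ_A)` times a member of `(n_B, d, δ_B)` is a member of `(n_A + n_B, d, δ_A δ_B)`. §2 the CONVERSE direction
for that product polarization: if `δ_A · δ_B ≠ [(-1)^{n_A+n_B}]` the class of §1 is NOT hyperbolic
(`VanGeemen1994.not_isHyperbolicWeilType_of_hasWeilDiscriminantNondeg_ne`: `det H` is well defined, Lemma 5.2 (3)) — together with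
file 1, the `K`-symmetrised Segre polarization of `A × B` is hyperbolic IFF `δ_A δ_B = [(-1)^{n_A+n_B}]`. §3 the `(n_A, n_B) = (1, 2)` instance of `Ring2AbelianAllEvenTimesEven.isSplitWeilType_prod_of_hasWeilDiscriminantNondeg`:
a Weil-type SURFACE pair `(S, φ)` (type `(1, d)`, `K`-symmetrised hyperplane class of non-degenerate class `δ_S`, necessarily
negative) times a Weil-type FOURFOLD pair `(X, ψ)` (type `(2, d)`, class `δ_X`, necessarily positive) is a `(3,3)` sixfold of
Weil type, SPLIT as soon as `δ_S · δ_X = [-1]` (`isSplitWeilType_surface_prod_fourfold`); its rational `(3,3)` Weil classes are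
then algebraic granted ONE printed hyperbolic-sixfold theorem applied DIRECTLY to the split pair — Markman 2025 Thm. 1.5.1
(any `d`, UNREFEREED), Koike 2004 (`d = 1`, refereed), Schoen 1998 (`d = 3`, refereed) — with no Landherr binder, no component
binder and no re-weighting residue (the shape of `Ring2AbelianAllOddTimesCurve` §2 for the even × even sixfolds).

## References

* [vanGeemen1994HodgeAV] B. van Geemen, LNM 1594 (1994), Lemma 5.2 (2)–(4), 5.4 and (5.4.1), 7.3.
* [Landherr1936HermitianForms] W. Landherr, Abh. Math. Sem. Hamburg 11 (1936) 245–248.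
* [Markman2025SecantWeil] E. Markman, arXiv:2502.03415, Thm. 1.5.1 (preprint, unrefereed).
* [Koike2004WeilHodge] K. Koike, Algebraicity of some Weil Hodge classes, Canad. Math. Bull. 47 (2004), Thm. 2.1, Cor. 2.1.
* [Schoen1998HodgeWeilAddendum] C. Schoen, Compositio Math. 114 (1998) 329–336.
-/

set_option linter.dupNamespace false

noncomputable section

open CategoryTheory MonoidalCategory

namespace Summit.HodgeConjecture.HodgeConjecture.Ring2.AbelianAll

open Literature.AlgebraicGeometry Literature.AlgebraicGeometry.Motives
open Literature.AlgebraicGeometry.HodgeTheory Literature.AlgebraicGeometry.VanGeemen1994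
open Literature.AlgebraicTopology.SingularHomology
open Literature.Geometry.Kaehler
open Summit.HodgeConjecture.HodgeConjecture.WeilTypeLadder
open Summit.HodgeConjecture.HodgeConjecture.Theses
open Summit.HodgeConjecture.HodgeConjecture.Ring2.Hypotheses

/-! ## §1 The component multiplication law on the carriers -/

/-- **COMPONENT MULTIPLICATION LAW** ("det H is multiplicative", for `K`-symmetrised HYPERPLANE classes). Let `(A, φ)`, `(B, ψ)`
have even dimensions `2n_A`, `2n_B` (`n_A, n_B ≥ 1`), `φ ≫ φ = -(d • 𝟙 A)`, `ψ ≫ ψ = -(d • 𝟙 B)`, `d ≥ 1`, and let the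
`K`-symmetrised hyperplane classes of `(e_A, a_A)`, `(e_B, a_B)` have non-degenerate discriminant classes `δ_A`, `δ_B`. Then there
are a projective embedding `e` of `A × B` and a rational ambient class `a ≠ 0` whose `K`-symmetrised hyperplane class
`d·e^*a + (φ × ψ)^*e^*a` has a non-degenerate discriminant witness of class `δ_A · δ_B`. No Weil-type hypothesis, no named fact:
`e` is the Segre embedding of `e_A ⊗ e_B` (`exists_segreEmbedding_prod_of_classes`: `e^*a = pr_A^* e_A^*a_A + c·pr_B^* e_B^*a_B`),
its `K`-symmetrisation is `pr_A^* h_A + pr_B^*(c·h_B)`, `c·h_B` has class `δ_B`, and `hasWeilDiscriminantNondeg_prod` (ab-weil-1;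
top self-intersections non-zero by `VanGeemen1994.prod_kFrames_top_ne_zero`). [cite: vanGeemen1994HodgeAV, Lemma 5.2 (2)–(3)]
[cite: Markman2025SurveySecant, §11.5 Step 2] [cite: Hartshorne1977, II Ex. 5.11 and Ex. 5.12] -/
theorem exists_ksymm_hasWeilDiscriminantNondeg_prod {A B : AbelianVariety ℂ} {φ : A ⟶ A} {ψ : B ⟶ B}
    {nA nB d : ℕ} (hnA : 0 < nA) (hnB : 0 < nB) (hA : A.dim = 2 * nA) (hB : B.dim = 2 * nB) (hd : 0 < d)
    (hφ : φ ≫ φ = -(d • 𝟙 A)) (hψ : ψ ≫ ψ = -(d • 𝟙 B))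
    (eA : ProjectiveEmbedding A.X) {aA : complexBetti (projectiveSpace eA.n ℂ) 2} (haA : IsRationalClass aA)
    (haA0 : aA ≠ 0)
    (eB : ProjectiveEmbedding B.X) {aB : complexBetti (projectiveSpace eB.n ℂ) 2} (haB : IsRationalClass aB)
    (haB0 : aB ≠ 0) {δA δB : weilNormResidueGroup d}
    (hWA : HasWeilDiscriminantNondeg A φ nA d
      ((d : ℂ) • complexBetti.map eA.ι 2 aA + complexBetti.map φ.hom.hom.hom 2 (complexBetti.map eA.ι 2 aA)) δA)
    (hWB : HasWeilDiscriminantNondeg B ψ nB d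
      ((d : ℂ) • complexBetti.map eB.ι 2 aB + complexBetti.map ψ.hom.hom.hom 2 (complexBetti.map eB.ι 2 aB)) δB) :
    ∃ (e : ProjectiveEmbedding (A.prod B).X) (a : complexBetti (projectiveSpace e.n ℂ) 2),
      IsRationalClass a ∧ a ≠ 0 ∧
      HasWeilDiscriminantNondeg (A.prod B)
        (AbelianVariety.prodLift (AbelianVariety.fst A B ≫ φ) (AbelianVariety.snd A B ≫ ψ)) (nA + nB) d
        ((d : ℂ) • complexBetti.map e.ι 2 a +
          complexBetti.map (AbelianVariety.prodLift (AbelianVariety.fst A B ≫ φ)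
            (AbelianVariety.snd A B ≫ ψ)).hom.hom.hom 2 (complexBetti.map e.ι 2 a)) (δA * δB) := by
  classical
  set Φ := AbelianVariety.prodLift (AbelianVariety.fst A B ≫ φ) (AbelianVariety.snd A B ≫ ψ) with hΦ
  set hKA := (d : ℂ) • complexBetti.map eA.ι 2 aA + complexBetti.map φ.hom.hom.hom 2 (complexBetti.map eA.ι 2 aA)
    with hKAdef
  set hKB := (d : ℂ) • complexBetti.map eB.ι 2 aB + complexBetti.map ψ.hom.hom.hom 2 (complexBetti.map eB.ι 2 aB)
    with hKBdef
  obtain ⟨e, a, c, ha, ha0, hc0, he⟩ := exists_segreEmbedding_prod_of_classes A B eA haA haA0 eB haB haB0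
  have hh : (d : ℂ) • complexBetti.map e.ι 2 a + complexBetti.map Φ.hom.hom.hom 2 (complexBetti.map e.ι 2 a) =
      complexBetti.map (AbelianVariety.fst A B).hom.hom.hom 2 hKA +
        complexBetti.map (AbelianVariety.snd A B).hom.hom.hom 2 (((c : ℚ) : ℂ) • hKB) := by
    rw [he, map_add, map_smul, map_prodLift_map_fst φ ψ 2, map_prodLift_map_snd φ ψ 2, hKAdef, hKBdef]
    simp only [map_add, map_smul, smul_add, smul_smul]
    rw [mul_comm ((c : ℚ) : ℂ) (d : ℂ)]
    abel
  have hWB' : HasWeilDiscriminantNondeg B ψ nB d (((c : ℚ) : ℂ) • hKB) δB :=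
    (hasWeilDiscriminantNondeg_ratCast_smul_iff hc0).2 hWB
  have hrA : IsRationalClass hKA := isRationalClass_ksymm d φ eA haA
  have hrB' : IsRationalClass (((c : ℚ) : ℂ) • hKB) := (isRationalClass_ksymm d ψ eB haB).smul c
  have hAdim : A.dim = 2 * nA - 1 + 1 := by omega
  have hBdim : B.dim = 2 * nB - 1 + 1 := by omega
  have hXA : IsSmoothProjective (2 * nA - 1 + 1) A.X := isSmoothProjective_of_dim_eq' hAdim
  have hXB : IsSmoothProjective (2 * nB - 1 + 1) B.X := isSmoothProjective_of_dim_eq' hBdim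
  obtain ⟨xA, ωA, amA, bmA, qA, hxA, hiA, hωA, hωA0, hQA, -, -⟩ := id hWA
  obtain ⟨xB, ωB, amB, bmB, qB, hxB, hiB, hωB, hωB0, hQB, -, -⟩ := id hWB'
  obtain ⟨dA, hdA⟩ := exists_eq_ratCast_smul_of_finrank_eq_one
    (Motives.finrank_complexBetti_two_add_two_mul_eq_one hXA) hωA hωA0
    (HodgeRiemannDegreeOne.IsRationalClass.lefschetzPow hrA (2 * nA - 1) hrA)
  obtain ⟨dB, hdB⟩ := exists_eq_ratCast_smul_of_finrank_eq_one
    (Motives.finrank_complexBetti_two_add_two_mul_eq_one hXB) hωB hωB0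
    (HodgeRiemannDegreeOne.IsRationalClass.lefschetzPow hrB' (2 * nB - 1) hrB')
  obtain ⟨hdA0, hdB0⟩ := prod_kFrames_top_ne_zero (N := nA + nB) hAdim hBdim (by omega) (by omega) (by omega)
    (by omega) hd hφ hψ xA hxA hiA hKA ωA amA bmA hQA dA hdA xB hxB hiB _ ωB amB bmB hQB dB hdB e ha ha0 hh
  have htA : lefschetzPow hKA (2 * nA - 1) 2 hKA ≠ 0 := by
    rw [hdA]; exact smul_ne_zero (by exact_mod_cast hdA0) hωA0
  have htB : lefschetzPow (((c : ℚ) : ℂ) • hKB) (2 * nB - 1) 2 (((c : ℚ) : ℂ) • hKB) ≠ 0 := by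
    rw [hdB]; exact smul_ne_zero (by exact_mod_cast hdB0) hωB0
  obtain ⟨hprod, -⟩ := hasWeilDiscriminantNondeg_prod hnA hnB hA hB hrA hrB' htA htB hWA hWB'
  rw [← hh] at hprod
  exact ⟨e, a, ha, ha0, hprod⟩

/-! ## §2 The converse for the product polarization: `δ_A · δ_B ≠ [(-1)^{n_A + n_B}]` is NOT hyperbolic -/

/-- **If `δ_A · δ_B ≠ [(-1)^{n_A + n_B}]`, the `K`-symmetrised Segre polarization of `A × B` is NOT hyperbolic** (`det H` of a
`K`-symmetrised hyperplane class is well defined on the carriers, van Geemen Lemma 5.2 (3), the tree's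
`VanGeemen1994.hasWeilDiscriminantNondeg_ksymm_unique`; a hyperbolic class has class `[(-1)ⁿ]`). Same hypotheses as
`exists_ksymm_hasWeilDiscriminantNondeg_prod`; conclusion: a projective embedding `e` of `A × B` and a rational `a ≠ 0` whose
`K`-symmetrised hyperplane class has class `δ_A δ_B` AND is not hyperbolic. (This does not make `(A × B, φ × ψ)` NON-split:
other polarizations of `A × B` may have other classes.) [cite: vanGeemen1994HodgeAV, Lemma 5.2 (3) and 5.4 (5.4.1)]
[cite: Markman2025SurveySecant, §11.5 Steps 1–2] -/
theorem exists_ksymm_not_isHyperbolicWeilType_prod_of_ne {A B : AbelianVariety ℂ} {φ : A ⟶ A} {ψ : B ⟶ B}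
    {nA nB d : ℕ} (hnA : 0 < nA) (hnB : 0 < nB) (hA : A.dim = 2 * nA) (hB : B.dim = 2 * nB) (hd : 0 < d)
    (hφ : φ ≫ φ = -(d • 𝟙 A)) (hψ : ψ ≫ ψ = -(d • 𝟙 B))
    (eA : ProjectiveEmbedding A.X) {aA : complexBetti (projectiveSpace eA.n ℂ) 2} (haA : IsRationalClass aA)
    (haA0 : aA ≠ 0)
    (eB : ProjectiveEmbedding B.X) {aB : complexBetti (projectiveSpace eB.n ℂ) 2} (haB : IsRationalClass aB)
    (haB0 : aB ≠ 0) {δA δB : weilNormResidueGroup d}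
    (hWA : HasWeilDiscriminantNondeg A φ nA d
      ((d : ℂ) • complexBetti.map eA.ι 2 aA + complexBetti.map φ.hom.hom.hom 2 (complexBetti.map eA.ι 2 aA)) δA)
    (hWB : HasWeilDiscriminantNondeg B ψ nB d
      ((d : ℂ) • complexBetti.map eB.ι 2 aB + complexBetti.map ψ.hom.hom.hom 2 (complexBetti.map eB.ι 2 aB)) δB)
    (hne : δA * δB ≠ QuotientGroup.mk ((-1 : ℚˣ) ^ (nA + nB))) :
    ∃ (e : ProjectiveEmbedding (A.prod B).X) (a : complexBetti (projectiveSpace e.n ℂ) 2),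
      IsRationalClass a ∧ a ≠ 0 ∧
      HasWeilDiscriminantNondeg (A.prod B)
        (AbelianVariety.prodLift (AbelianVariety.fst A B ≫ φ) (AbelianVariety.snd A B ≫ ψ)) (nA + nB) d
        ((d : ℂ) • complexBetti.map e.ι 2 a +
          complexBetti.map (AbelianVariety.prodLift (AbelianVariety.fst A B ≫ φ)
            (AbelianVariety.snd A B ≫ ψ)).hom.hom.hom 2 (complexBetti.map e.ι 2 a)) (δA * δB) ∧
      ¬ IsHyperbolicWeilType (A.prod B)
        (AbelianVariety.prodLift (AbelianVariety.fst A B ≫ φ) (AbelianVariety.snd A B ≫ ψ)) (nA + nB)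
        ((d : ℂ) • complexBetti.map e.ι 2 a +
          complexBetti.map (AbelianVariety.prodLift (AbelianVariety.fst A B ≫ φ)
            (AbelianVariety.snd A B ≫ ψ)).hom.hom.hom 2 (complexBetti.map e.ι 2 a)) := by
  obtain ⟨e, a, ha, ha0, hδ⟩ :=
    exists_ksymm_hasWeilDiscriminantNondeg_prod hnA hnB hA hB hd hφ hψ eA haA haA0 eB haB haB0 hWA hWB
  have hdim : (A.prod B).dim = 2 * (nA + nB) := by rw [AbelianVariety.dim_prod, hA, hB]; ring
  exact ⟨e, a, ha, ha0, hδ, not_isHyperbolicWeilType_of_hasWeilDiscriminantNondeg_ne (Nat.add_pos_left hnA nB) hdim hd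
    (prodLift_comp_self_eq_neg_nsmul hφ hψ) e ha ha0 hδ hne⟩

/-- **Split × split ⟹ split, sharpened: a split pair times a pair whose `K`-symmetrised hyperplane class is NOT of the split
class has a non-hyperbolic Segre polarization** — e.g. `X₂ × X₂′` for a split and a non-split Weil fourfold over the same `K`:
the `(4,4)` eightfold's Segre product polarizations are not hyperbolic (classes `[1]·δ′ = δ′ ≠ [1]`).
[cite: vanGeemen1994HodgeAV, Lemma 5.2 (3) and (5.4.1)] -/
theorem exists_ksymm_not_isHyperbolicWeilType_prod_of_split_of_ne {A B : AbelianVariety ℂ} {φ : A ⟶ A} {ψ : B ⟶ B}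
    {nA nB d : ℕ} (hnA : 0 < nA) (hnB : 0 < nB) (hA : A.dim = 2 * nA) (hB : B.dim = 2 * nB) (hd : 0 < d)
    (hφ : φ ≫ φ = -(d • 𝟙 A)) (hψ : ψ ≫ ψ = -(d • 𝟙 B))
    (eA : ProjectiveEmbedding A.X) {aA : complexBetti (projectiveSpace eA.n ℂ) 2} (haA : IsRationalClass aA)
    (haA0 : aA ≠ 0)
    (eB : ProjectiveEmbedding B.X) {aB : complexBetti (projectiveSpace eB.n ℂ) 2} (haB : IsRationalClass aB)
    (haB0 : aB ≠ 0) {δB : weilNormResidueGroup d}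
    (hWA : HasWeilDiscriminantNondeg A φ nA d
      ((d : ℂ) • complexBetti.map eA.ι 2 aA + complexBetti.map φ.hom.hom.hom 2 (complexBetti.map eA.ι 2 aA))
      (QuotientGroup.mk ((-1 : ℚˣ) ^ nA)))
    (hWB : HasWeilDiscriminantNondeg B ψ nB d
      ((d : ℂ) • complexBetti.map eB.ι 2 aB + complexBetti.map ψ.hom.hom.hom 2 (complexBetti.map eB.ι 2 aB)) δB)
    (hne : δB ≠ QuotientGroup.mk ((-1 : ℚˣ) ^ nB)) :
    ∃ (e : ProjectiveEmbedding (A.prod B).X) (a : complexBetti (projectiveSpace e.n ℂ) 2),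
      IsRationalClass a ∧ a ≠ 0 ∧
      ¬ IsHyperbolicWeilType (A.prod B)
        (AbelianVariety.prodLift (AbelianVariety.fst A B ≫ φ) (AbelianVariety.snd A B ≫ ψ)) (nA + nB)
        ((d : ℂ) • complexBetti.map e.ι 2 a +
          complexBetti.map (AbelianVariety.prodLift (AbelianVariety.fst A B ≫ φ)
            (AbelianVariety.snd A B ≫ ψ)).hom.hom.hom 2 (complexBetti.map e.ι 2 a)) := by
  have hne' : QuotientGroup.mk ((-1 : ℚˣ) ^ nA) * δB ≠ QuotientGroup.mk ((-1 : ℚˣ) ^ (nA + nB)) := by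
    intro h
    apply hne
    rw [pow_add, QuotientGroup.mk_mul] at h
    exact mul_left_cancel h
  obtain ⟨e, a, ha, ha0, -, hnot⟩ :=
    exists_ksymm_not_isHyperbolicWeilType_prod_of_ne hnA hnB hA hB hd hφ hψ eA haA haA0 eB haB haB0 hWA hWB hne'
  exact ⟨e, a, ha, ha0, hnot⟩

/-! ## §3 Surface × fourfold: split Weil sixfolds from two even factors, and their Weil classes from ONE sixfold fact -/

/-- **A Weil-type surface pair times a Weil-type fourfold pair with `δ_S · δ_X = [-1]` is a SPLIT (3,3) sixfold**
(`(S, φ)` of Weil type `(1, d)`, `(X, ψ)` of Weil type `(2, d)`, `K`-symmetrised hyperplane classes of non-degenerate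
classes `δ_S`, `δ_X`). [cite: vanGeemen1994HodgeAV, Lemma 5.2 (2)–(4) and (5.4.1)] [cite: Landherr1936HermitianForms] -/
theorem isSplitWeilType_surface_prod_fourfold {S X : AbelianVariety ℂ} {φ : S ⟶ S} {ψ : X ⟶ X} {d : ℕ}
    (hWS : IsWeilType S φ 1 d) (hWX : IsWeilType X ψ 2 d)
    (eS : ProjectiveEmbedding S.X) {aS : complexBetti (projectiveSpace eS.n ℂ) 2} (haS : IsRationalClass aS)
    (haS0 : aS ≠ 0)
    (eX : ProjectiveEmbedding X.X) {aX : complexBetti (projectiveSpace eX.n ℂ) 2} (haX : IsRationalClass aX)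
    (haX0 : aX ≠ 0) {δS δX : weilNormResidueGroup d}
    (hδS : HasWeilDiscriminantNondeg S φ 1 d
      ((d : ℂ) • complexBetti.map eS.ι 2 aS + complexBetti.map φ.hom.hom.hom 2 (complexBetti.map eS.ι 2 aS)) δS)
    (hδX : HasWeilDiscriminantNondeg X ψ 2 d
      ((d : ℂ) • complexBetti.map eX.ι 2 aX + complexBetti.map ψ.hom.hom.hom 2 (complexBetti.map eX.ι 2 aX)) δX)
    (hδ : δS * δX = QuotientGroup.mk (-1 : ℚˣ)) :
    IsSplitWeilType (S.prod X)
      (AbelianVariety.prodLift (AbelianVariety.fst S X ≫ φ) (AbelianVariety.snd S X ≫ ψ)) 3 d :=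
  isSplitWeilType_prod_of_hasWeilDiscriminantNondeg (nA := 1) (nB := 2) one_pos two_pos hWS.dim_eq hWX.dim_eq
    hWS.sq_eq hWX.sq_eq eS haS haS0 eX haX haX0 hδS hδX (isWeilType_prod hWS hWX) (by rw [hδ]; rfl)

/-- **The Weil classes of such a split sixfold `S × X` are algebraic granted Markman's hyperbolic-sixfold statement F2
ALONE** (UNREFEREED named fact `hM`, applied directly to the split pair; any `d ≥ 1`).
[cite: Markman2025SecantWeil, Thm. 1.5.1 (preprint, unrefereed)] [cite: vanGeemen1994HodgeAV, (5.4.1)] -/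
theorem weilClasses_algebraic_surface_prod_fourfold_of_markmanSixfolds
    (hM : Markman2025_weilClasses_algebraic_hyperbolicSixfold)
    {S X : AbelianVariety ℂ} {φ : S ⟶ S} {ψ : X ⟶ X} {d : ℕ} (hWS : IsWeilType S φ 1 d) (hWX : IsWeilType X ψ 2 d)
    (eS : ProjectiveEmbedding S.X) {aS : complexBetti (projectiveSpace eS.n ℂ) 2} (haS : IsRationalClass aS)
    (haS0 : aS ≠ 0)
    (eX : ProjectiveEmbedding X.X) {aX : complexBetti (projectiveSpace eX.n ℂ) 2} (haX : IsRationalClass aX)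
    (haX0 : aX ≠ 0) {δS δX : weilNormResidueGroup d}
    (hδS : HasWeilDiscriminantNondeg S φ 1 d
      ((d : ℂ) • complexBetti.map eS.ι 2 aS + complexBetti.map φ.hom.hom.hom 2 (complexBetti.map eS.ι 2 aS)) δS)
    (hδX : HasWeilDiscriminantNondeg X ψ 2 d
      ((d : ℂ) • complexBetti.map eX.ι 2 aX + complexBetti.map ψ.hom.hom.hom 2 (complexBetti.map eX.ι 2 aX)) δX)
    (hδ : δS * δX = QuotientGroup.mk (-1 : ℚˣ))
    {c : complexBetti (S.prod X).X (2 * 3)} (hcQ : IsRationalClass c)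
    (hcH : IsOfHodgeType (2 * 3) (S.prod X).X (2 * 3) 3 3 c)
    (hw : c ∈ weilClassesOf (S.prod X)
      (AbelianVariety.prodLift (AbelianVariety.fst S X ≫ φ) (AbelianVariety.snd S X ≫ ψ)) 3 d) :
    c ∈ algebraicClasses (S.prod X).X 3 := by
  obtain ⟨-, hd, hP, hΦ2, e, a, ha, ha0, hh⟩ :=
    isSplitWeilType_iff.1 (isSplitWeilType_surface_prod_fourfold hWS hWX eS haS haS0 eX haX haX0 hδS hδX hδ)
  exact hM d hd (S.prod X) _ hP (isSmoothProjective_of_dim_eq' hP) hΦ2 e a ha ha0 hh c hcQ hcH hw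

/-- **`k = ℚ(i)`: the Weil classes of the split sixfold `S × X` are algebraic granted Koike 2004 ALONE** (refereed named
fact `hK`). [cite: Koike2004WeilHodge, Thm. 2.1 and Cor. 2.1] [cite: vanGeemen1994HodgeAV, (5.4.1)] -/
theorem weilClasses_algebraic_surface_prod_fourfold_of_koike (hK : Koike2004_weilClasses_algebraic_hyperbolicSixfold_one)
    {S X : AbelianVariety ℂ} {φ : S ⟶ S} {ψ : X ⟶ X} (hWS : IsWeilType S φ 1 1) (hWX : IsWeilType X ψ 2 1)
    (eS : ProjectiveEmbedding S.X) {aS : complexBetti (projectiveSpace eS.n ℂ) 2} (haS : IsRationalClass aS)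
    (haS0 : aS ≠ 0)
    (eX : ProjectiveEmbedding X.X) {aX : complexBetti (projectiveSpace eX.n ℂ) 2} (haX : IsRationalClass aX)
    (haX0 : aX ≠ 0) {δS δX : weilNormResidueGroup 1}
    (hδS : HasWeilDiscriminantNondeg S φ 1 1
      (((1 : ℕ) : ℂ) • complexBetti.map eS.ι 2 aS + complexBetti.map φ.hom.hom.hom 2 (complexBetti.map eS.ι 2 aS)) δS)
    (hδX : HasWeilDiscriminantNondeg X ψ 2 1
      (((1 : ℕ) : ℂ) • complexBetti.map eX.ι 2 aX + complexBetti.map ψ.hom.hom.hom 2 (complexBetti.map eX.ι 2 aX)) δX)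
    (hδ : δS * δX = QuotientGroup.mk (-1 : ℚˣ))
    {c : complexBetti (S.prod X).X (2 * 3)} (hcQ : IsRationalClass c)
    (hcH : IsOfHodgeType (2 * 3) (S.prod X).X (2 * 3) 3 3 c)
    (hw : c ∈ weilClassesOf (S.prod X)
      (AbelianVariety.prodLift (AbelianVariety.fst S X ≫ φ) (AbelianVariety.snd S X ≫ ψ)) 3 1) :
    c ∈ algebraicClasses (S.prod X).X 3 := by
  obtain ⟨-, -, hP, hΦ2, e, a, ha, ha0, hh⟩ :=
    isSplitWeilType_iff.1 (isSplitWeilType_surface_prod_fourfold hWS hWX eS haS haS0 eX haX haX0 hδS hδX hδ)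
  exact hK (S.prod X) _ hP (isSmoothProjective_of_dim_eq' hP) hΦ2 e a ha ha0 hh c hcQ hcH hw

/-- **`k = ℚ(√-3)`: the Weil classes of the split sixfold `S × X` are algebraic granted Schoen 1998 ALONE** (refereed
named fact `hS3`). [cite: Schoen1998HodgeWeilAddendum] [cite: vanGeemen1994HodgeAV, 7.3 and (5.4.1)] -/
theorem weilClasses_algebraic_surface_prod_fourfold_of_schoen
    (hS3 : Schoen1998_weilClasses_algebraic_hyperbolicSixfold_three)
    {S X : AbelianVariety ℂ} {φ : S ⟶ S} {ψ : X ⟶ X} (hWS : IsWeilType S φ 1 3) (hWX : IsWeilType X ψ 2 3)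
    (eS : ProjectiveEmbedding S.X) {aS : complexBetti (projectiveSpace eS.n ℂ) 2} (haS : IsRationalClass aS)
    (haS0 : aS ≠ 0)
    (eX : ProjectiveEmbedding X.X) {aX : complexBetti (projectiveSpace eX.n ℂ) 2} (haX : IsRationalClass aX)
    (haX0 : aX ≠ 0) {δS δX : weilNormResidueGroup 3}
    (hδS : HasWeilDiscriminantNondeg S φ 1 3
      (((3 : ℕ) : ℂ) • complexBetti.map eS.ι 2 aS + complexBetti.map φ.hom.hom.hom 2 (complexBetti.map eS.ι 2 aS)) δS)
    (hδX : HasWeilDiscriminantNondeg X ψ 2 3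
      (((3 : ℕ) : ℂ) • complexBetti.map eX.ι 2 aX + complexBetti.map ψ.hom.hom.hom 2 (complexBetti.map eX.ι 2 aX)) δX)
    (hδ : δS * δX = QuotientGroup.mk (-1 : ℚˣ))
    {c : complexBetti (S.prod X).X (2 * 3)} (hcQ : IsRationalClass c)
    (hcH : IsOfHodgeType (2 * 3) (S.prod X).X (2 * 3) 3 3 c)
    (hw : c ∈ weilClassesOf (S.prod X)
      (AbelianVariety.prodLift (AbelianVariety.fst S X ≫ φ) (AbelianVariety.snd S X ≫ ψ)) 3 3) :
    c ∈ algebraicClasses (S.prod X).X 3 := by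
  obtain ⟨-, -, hP, hΦ2, e, a, ha, ha0, hh⟩ :=
    isSplitWeilType_iff.1 (isSplitWeilType_surface_prod_fourfold hWS hWX eS haS haS0 eX haX haX0 hδS hδX hδ)
  exact hS3 (S.prod X) _ hP (isSmoothProjective_of_dim_eq' hP) hΦ2 e a ha ha0 hh c hcQ hcH hw

end Summit.HodgeConjecture.HodgeConjecture.Ring2.AbelianAll

end
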